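import Literature.AlgebraicGeometry.HodgeTheory.RibetTypeFiveAllPowersHodgeClasses
import Literature.AlgebraicGeometry.Motives.HodgeThetaSubalgebraUnitarySixSevenCoreAll
import HarnessLib

/-!
# Hodge classes on all powers of abelian varieties of Ribet type `(6, n″)`, `gcd(6, n″) = 1`, and `(7, n″)`, `7 ∤ n″`,
# are generated by divisor classes (Ribet 1983 Thm. 3 at these multiplicities — UNCONDITIONAL; `17 = 6 + 11 = 7 + 10`, `19 = 6 + 13 = 7 + 12`)

Family `hodge`, layer `Literature/AlgebraicGeometry/HodgeTheory`. Research context: cell `pub-hodge-ring2` (HONEST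
FRAMING: research route conditional on HC_CM; not a corollary; Q11.4-sentence-2 already refuted in dim ≥ 3),
Literature lane gen 84, programme R67. UNCONDITIONAL for the class of abelian varieties it names; theorems only, no
definition, no named fact (D-0026), no `sorry`. The CELLS of the generic assembly `RibetTypeOfCoreSmulPowersHodgeClasses`
at the cores `UnitarySix.eq_top_of_smul` and `UnitarySeven.eq_top_of_smul` (`Motives/HodgeThetaSubalgebraUnitarySixSevenCoreAll`,
triple route at the top rank), and the census they close: in prime dimension `p ≥ 11` the imaginary-quadratic residual of
`TankeevRibet1983_hodgeClasses_divisorial_powers_simplePrimeDimension` is now `min(n′, n″) ≥ 8` (dimension `17`: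
`{8, 9}`; dimension `19`: `{8, 11}`, `{9, 10}`).

THE PRINTED THEOREM. Ribet, Amer. J. Math. 105 (1983), Thm. 3 = Gordon's survey Thm. 6.3 (3) [held
`paper:arxiv-alg-geom_9709030` p. 18].

## References
* [Ribet1983] K. A. Ribet, Amer. J. Math. 105 (1983), Thm. 0 and Thm. 3.
* [Gordon1997] B. B. Gordon, *A survey of the Hodge conjecture for abelian varieties*, Thm. 6.3 (3) and Corollary.
* [MoonenZarhin1999LowDim] B. Moonen, Yu. Zarhin, Math. Ann. 315 (1999), §2 (2.4), Thm. (2.7).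
* [Deligne2000] P. Deligne, *The Hodge conjecture* (Clay, 2000), §1.
-/

noncomputable section

open CategoryTheory Module

namespace Literature.AlgebraicGeometry.HodgeTheory

open Literature.AlgebraicGeometry.Motives
open Literature.AlgebraicGeometry.Motives.HodgeStructure

section Cells

/-- **Ribet 1983 Thm. 3 at `(6, n″)`, `gcd(6, n″) = 1` — UNCONDITIONAL: `B•(A^{N+1}) = D•(A^{N+1}) ⊗ ℂ`** (`φ ≫ φ = -d`,
`finrank_ℚ End⁰(A) = 2`, `n_{i√d}(φ) = 6`, `n_{−i√d}(φ)` odd and prime to `3`; core `UnitarySix.eq_top_of_smul`).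
[cite: Ribet1983, Thm. 0 and Thm. 3] [cite: Gordon1997, Thm. 6.3 (3) and Corollary] -/
theorem AbelianVariety.isDivisorGenerated_powSucc_of_ribetTypeSixAll (A : AbelianVariety ℂ) (φ : A ⟶ A)
    {d : ℕ} (hd : 0 < d) (hφ : φ ≫ φ = -(d • 𝟙 A)) (hE2 : Module.finrank ℚ A.endAlgebra = 2)
    (h6 : eigenMultiplicity A φ (Complex.I * (Real.sqrt d : ℂ)) = 6)
    (hodd : Odd (eigenMultiplicity A φ (-(Complex.I * (Real.sqrt d : ℂ)))))
    (h3 : ¬ 3 ∣ eigenMultiplicity A φ (-(Complex.I * (Real.sqrt d : ℂ)))) (N : ℕ) :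
    IsDivisorGenerated (A.powSucc N) := by
  have hpos' : 0 < eigenMultiplicity A φ (-(Complex.I * (Real.sqrt d : ℂ))) := by obtain ⟨k, hk⟩ := hodd; omega
  refine AbelianVariety.isDivisorGenerated_powSucc_of_ribetType_ofCoreSmul A φ hd hφ hE2 (by omega) hpos' ?_ N
  intro W' _ _ _ 𝔊 ι P' Q' s hbr hirr hι hιι hP' hQ' hfinP' hfinQ' hadd hsmul hsymm hPQ hdefP hdefQ hadj
  exact UnitarySix.eq_top_of_smul hbr hirr hι hιι hP' hQ' (by rw [hfinP', h6]) (by rw [hfinQ']; exact hodd)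
    (by rw [hfinQ']; exact h3) hadd hsmul hsymm hPQ hdefP hdefQ hadj

/-- The mirror: `n_{−i√d}(φ) = 6`, `n_{i√d}(φ)` odd and prime to `3` (core `UnitarySix.eq_top_of_smul'`).
[cite: Ribet1983, Thm. 0 and Thm. 3] [cite: Gordon1997, Thm. 6.3 (3) and Corollary] -/
theorem AbelianVariety.isDivisorGenerated_powSucc_of_ribetTypeSixAll' (A : AbelianVariety ℂ) (φ : A ⟶ A)
    {d : ℕ} (hd : 0 < d) (hφ : φ ≫ φ = -(d • 𝟙 A)) (hE2 : Module.finrank ℚ A.endAlgebra = 2)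
    (hodd : Odd (eigenMultiplicity A φ (Complex.I * (Real.sqrt d : ℂ))))
    (h3 : ¬ 3 ∣ eigenMultiplicity A φ (Complex.I * (Real.sqrt d : ℂ)))
    (h6 : eigenMultiplicity A φ (-(Complex.I * (Real.sqrt d : ℂ))) = 6) (N : ℕ) :
    IsDivisorGenerated (A.powSucc N) := by
  have hpos : 0 < eigenMultiplicity A φ (Complex.I * (Real.sqrt d : ℂ)) := by obtain ⟨k, hk⟩ := hodd; omega
  refine AbelianVariety.isDivisorGenerated_powSucc_of_ribetType_ofCoreSmul A φ hd hφ hE2 hpos (by omega) ?_ N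
  intro W' _ _ _ 𝔊 ι P' Q' s hbr hirr hι hιι hP' hQ' hfinP' hfinQ' hadd hsmul hsymm hPQ hdefP hdefQ hadj
  exact UnitarySix.eq_top_of_smul' hbr hirr hι hιι hP' hQ' (by rw [hfinP']; exact hodd) (by rw [hfinP']; exact h3)
    (by rw [hfinQ', h6]) hadd hsmul hsymm hPQ hdefP hdefQ hadj

/-- **Ribet 1983 Thm. 3 at `(7, n″)`, `7 ∤ n″` — UNCONDITIONAL: `B•(A^{N+1}) = D•(A^{N+1}) ⊗ ℂ`** (`φ ≫ φ = -d`,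
`finrank_ℚ End⁰(A) = 2`, `n_{i√d}(φ) = 7`, `7 ∤ n_{−i√d}(φ)`; core `UnitarySeven.eq_top_of_smul`).
[cite: Ribet1983, Thm. 0 and Thm. 3] [cite: Gordon1997, Thm. 6.3 (3) and Corollary] -/
theorem AbelianVariety.isDivisorGenerated_powSucc_of_ribetTypeSevenAll (A : AbelianVariety ℂ) (φ : A ⟶ A)
    {d : ℕ} (hd : 0 < d) (hφ : φ ≫ φ = -(d • 𝟙 A)) (hE2 : Module.finrank ℚ A.endAlgebra = 2)
    (h7 : eigenMultiplicity A φ (Complex.I * (Real.sqrt d : ℂ)) = 7)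
    (h7' : ¬ 7 ∣ eigenMultiplicity A φ (-(Complex.I * (Real.sqrt d : ℂ)))) (N : ℕ) :
    IsDivisorGenerated (A.powSucc N) := by
  refine AbelianVariety.isDivisorGenerated_powSucc_of_ribetType_ofCoreSmul A φ hd hφ hE2 (by omega) (by omega) ?_ N
  intro W' _ _ _ 𝔊 ι P' Q' s hbr hirr hι hιι hP' hQ' hfinP' hfinQ' hadd hsmul hsymm hPQ hdefP hdefQ hadj
  exact UnitarySeven.eq_top_of_smul hbr hirr hι hιι hP' hQ' (by rw [hfinP', h7]) (by rw [hfinQ']; exact h7')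
    hadd hsmul hsymm hPQ hdefP hdefQ hadj

/-- The mirror: `7 ∤ n_{i√d}(φ)`, `n_{−i√d}(φ) = 7` (core `UnitarySeven.eq_top_of_smul'`).
[cite: Ribet1983, Thm. 0 and Thm. 3] [cite: Gordon1997, Thm. 6.3 (3) and Corollary] -/
theorem AbelianVariety.isDivisorGenerated_powSucc_of_ribetTypeSevenAll' (A : AbelianVariety ℂ) (φ : A ⟶ A)
    {d : ℕ} (hd : 0 < d) (hφ : φ ≫ φ = -(d • 𝟙 A)) (hE2 : Module.finrank ℚ A.endAlgebra = 2)
    (h7' : ¬ 7 ∣ eigenMultiplicity A φ (Complex.I * (Real.sqrt d : ℂ)))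
    (h7 : eigenMultiplicity A φ (-(Complex.I * (Real.sqrt d : ℂ))) = 7) (N : ℕ) :
    IsDivisorGenerated (A.powSucc N) := by
  refine AbelianVariety.isDivisorGenerated_powSucc_of_ribetType_ofCoreSmul A φ hd hφ hE2 (by omega) (by omega) ?_ N
  intro W' _ _ _ 𝔊 ι P' Q' s hbr hirr hι hιι hP' hQ' hfinP' hfinQ' hadd hsmul hsymm hPQ hdefP hdefQ hadj
  exact UnitarySeven.eq_top_of_smul' hbr hirr hι hιι hP' hQ' (by rw [hfinP']; exact h7') (by rw [hfinQ', h7])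
    hadd hsmul hsymm hPQ hdefP hdefQ hadj

/-- **The Hodge conjecture for all powers of an abelian variety of unitary type `(6, n″)`, `gcd(6, n″) = 1` —
UNCONDITIONAL** (e.g. SEVENTEENFOLDS `(6,11)`, NINETEENFOLDS `(6,13)`). [cite: Ribet1983, Thm. 3] [cite: Deligne2000, §1] -/
theorem hodgeConjectureFor_powSucc_of_ribetTypeSixAll (A : AbelianVariety ℂ) (φ : A ⟶ A)
    {d : ℕ} (hd : 0 < d) (hφ : φ ≫ φ = -(d • 𝟙 A)) (hE2 : Module.finrank ℚ A.endAlgebra = 2)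
    (h6 : eigenMultiplicity A φ (Complex.I * (Real.sqrt d : ℂ)) = 6)
    (hodd : Odd (eigenMultiplicity A φ (-(Complex.I * (Real.sqrt d : ℂ)))))
    (h3 : ¬ 3 ∣ eigenMultiplicity A φ (-(Complex.I * (Real.sqrt d : ℂ)))) (N : ℕ) :
    HodgeConjectureFor (A.powSucc N).dim (A.powSucc N).X :=
  hodgeConjectureFor_of_isDivisorGenerated _
    (AbelianVariety.isDivisorGenerated_powSucc_of_ribetTypeSixAll A φ hd hφ hE2 h6 hodd h3 N)

/-- **The Hodge conjecture for all powers of an abelian variety of unitary type `(7, n″)`, `7 ∤ n″` — UNCONDITIONAL**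
(e.g. SEVENTEENFOLDS `(7,10)`, NINETEENFOLDS `(7,12)`). [cite: Ribet1983, Thm. 3] [cite: Deligne2000, §1] -/
theorem hodgeConjectureFor_powSucc_of_ribetTypeSevenAll (A : AbelianVariety ℂ) (φ : A ⟶ A)
    {d : ℕ} (hd : 0 < d) (hφ : φ ≫ φ = -(d • 𝟙 A)) (hE2 : Module.finrank ℚ A.endAlgebra = 2)
    (h7 : eigenMultiplicity A φ (Complex.I * (Real.sqrt d : ℂ)) = 7)
    (h7' : ¬ 7 ∣ eigenMultiplicity A φ (-(Complex.I * (Real.sqrt d : ℂ)))) (N : ℕ) :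
    HodgeConjectureFor (A.powSucc N).dim (A.powSucc N).X :=
  hodgeConjectureFor_of_isDivisorGenerated _
    (AbelianVariety.isDivisorGenerated_powSucc_of_ribetTypeSevenAll A φ hd hφ hE2 h7 h7' N)

/-- **SEVENTEENFOLDS of signature `{6,11}` or `{7,10}`: `B• = D•` on all powers — UNCONDITIONAL.**
[cite: Ribet1983, Thm. 0 and Thm. 3] [cite: MoonenZarhin1999LowDim, §2 (2.4)] -/
theorem AbelianVariety.isDivisorGenerated_powSucc_of_seventeenfold_sixEleven_sevenTen (A : AbelianVariety ℂ)
    (φ : A ⟶ A) {d : ℕ} (hd : 0 < d) (hφ : φ ≫ φ = -(d • 𝟙 A)) (hE2 : Module.finrank ℚ A.endAlgebra = 2)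
    (hX : A.dim = 17)
    (h67 : eigenMultiplicity A φ (Complex.I * (Real.sqrt d : ℂ)) = 6 ∨ eigenMultiplicity A φ (Complex.I * (Real.sqrt d : ℂ)) = 7 ∨
      eigenMultiplicity A φ (-(Complex.I * (Real.sqrt d : ℂ))) = 6 ∨ eigenMultiplicity A φ (-(Complex.I * (Real.sqrt d : ℂ))) = 7)
    (N : ℕ) : IsDivisorGenerated (A.powSucc N) := by
  have hsum := eigenMultiplicity_add_eigenMultiplicity_neg_eq_dim A φ hd hφ
  rw [hX] at hsum
  rcases h67 with h | h | h | h
  · exact AbelianVariety.isDivisorGenerated_powSucc_of_ribetTypeSixAll A φ hd hφ hE2 h ⟨5, by omega⟩ (by omega) N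
  · exact AbelianVariety.isDivisorGenerated_powSucc_of_ribetTypeSevenAll A φ hd hφ hE2 h (by omega) N
  · exact AbelianVariety.isDivisorGenerated_powSucc_of_ribetTypeSixAll' A φ hd hφ hE2 ⟨5, by omega⟩ (by omega) h N
  · exact AbelianVariety.isDivisorGenerated_powSucc_of_ribetTypeSevenAll' A φ hd hφ hE2 (by omega) h N

/-- **NINETEENFOLDS of signature `{6,13}` or `{7,12}`: `B• = D•` on all powers — UNCONDITIONAL.**
[cite: Ribet1983, Thm. 0 and Thm. 3] [cite: MoonenZarhin1999LowDim, §2 (2.4)] -/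
theorem AbelianVariety.isDivisorGenerated_powSucc_of_nineteenfold_sixThirteen_sevenTwelve (A : AbelianVariety ℂ)
    (φ : A ⟶ A) {d : ℕ} (hd : 0 < d) (hφ : φ ≫ φ = -(d • 𝟙 A)) (hE2 : Module.finrank ℚ A.endAlgebra = 2)
    (hX : A.dim = 19)
    (h67 : eigenMultiplicity A φ (Complex.I * (Real.sqrt d : ℂ)) = 6 ∨ eigenMultiplicity A φ (Complex.I * (Real.sqrt d : ℂ)) = 7 ∨
      eigenMultiplicity A φ (-(Complex.I * (Real.sqrt d : ℂ))) = 6 ∨ eigenMultiplicity A φ (-(Complex.I * (Real.sqrt d : ℂ))) = 7)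
    (N : ℕ) : IsDivisorGenerated (A.powSucc N) := by
  have hsum := eigenMultiplicity_add_eigenMultiplicity_neg_eq_dim A φ hd hφ
  rw [hX] at hsum
  rcases h67 with h | h | h | h
  · exact AbelianVariety.isDivisorGenerated_powSucc_of_ribetTypeSixAll A φ hd hφ hE2 h ⟨6, by omega⟩ (by omega) N
  · exact AbelianVariety.isDivisorGenerated_powSucc_of_ribetTypeSevenAll A φ hd hφ hE2 h (by omega) N
  · exact AbelianVariety.isDivisorGenerated_powSucc_of_ribetTypeSixAll' A φ hd hφ hE2 ⟨6, by omega⟩ (by omega) h N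
  · exact AbelianVariety.isDivisorGenerated_powSucc_of_ribetTypeSevenAll' A φ hd hφ hE2 (by omega) h N

end Cells

/-! ### Census: the Tankeev–Ribet residual is `min(n′, n″) ≥ 8` -/

section Census

/-- **The Tankeev–Ribet fact is EQUIVALENT to: (S1) `End⁰ = ℚ` in prime dimension `≥ 11`, and (S2⁸) imaginary-quadratic
multiplicities both `≥ 8`** (dimension `17`: only `{8,9}` remains; dimension `19`: `{8,11}`, `{9,10}`; dimension `23`:
`{8,15}`, `{9,14}`, `{10,13}`, `{11,12}`). [cite: MoonenZarhin1999LowDim, §2 (2.4)–(2.7)] [cite: Gordon1999HodgeAVSurvey, Thm. 6.3 and Corollary]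
[cite: Ribet1983, Thms. 1 and 3] -/
theorem tankeevRibet1983_iff_generic_ge_eleven_and_unitary_ge_eight :
    TankeevRibet1983_hodgeClasses_divisorial_powers_simplePrimeDimension ↔
      (∀ X : AbelianVariety ℂ, X.dim.Prime → 11 ≤ X.dim → X.IsSimple → Module.finrank ℚ X.endAlgebra = 1 →
        ∀ N : ℕ, IsDivisorGenerated (X.powSucc N)) ∧
      (∀ (X : AbelianVariety ℂ) (φ : X ⟶ X) (d : ℕ), X.dim.Prime → X.IsSimple → 0 < d →
        φ ≫ φ = -(d • 𝟙 X) → Module.finrank ℚ X.endAlgebra = 2 →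
        8 ≤ eigenMultiplicity X φ (Complex.I * (Real.sqrt d : ℂ)) →
        8 ≤ eigenMultiplicity X φ (-(Complex.I * (Real.sqrt d : ℂ))) →
        ∀ N : ℕ, IsDivisorGenerated (X.powSucc N)) := by
  rw [tankeevRibet1983_iff_generic_ge_eleven_and_unitary_ge_six]
  refine ⟨fun ⟨hS1, hS7⟩ => ⟨hS1, fun X φ d hp hs hd hφ he2 ha hb N =>
    hS7 X φ d hp hs hd hφ he2 (by omega) (by omega) (by omega) (by omega) N⟩,
    fun ⟨hS1, hS8⟩ => ⟨hS1, ?_⟩⟩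
  intro X φ d hp hs hd hφ he2 ha hb _ _ N
  have hsum := eigenMultiplicity_add_eigenMultiplicity_neg_eq_dim X φ hd hφ
  -- the prime `X.dim ≥ 12` is odd and divisible neither by `3` nor by `7`
  have h2dim : ¬ 2 ∣ X.dim := fun h => by have := Nat.Prime.eq_one_or_self_of_dvd hp 2 h; omega
  have h3dim : ¬ 3 ∣ X.dim := fun h => by have := Nat.Prime.eq_one_or_self_of_dvd hp 3 h; omega
  have h7dim : ¬ 7 ∣ X.dim := fun h => by have := Nat.Prime.eq_one_or_self_of_dvd hp 7 h; omega
  by_cases h6a : eigenMultiplicity X φ (Complex.I * (Real.sqrt d : ℂ)) = 6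
  · refine AbelianVariety.isDivisorGenerated_powSucc_of_ribetTypeSixAll X φ hd hφ he2 h6a
      ⟨eigenMultiplicity X φ (-(Complex.I * (Real.sqrt d : ℂ))) / 2, by omega⟩ (by omega) N
  by_cases h6b : eigenMultiplicity X φ (-(Complex.I * (Real.sqrt d : ℂ))) = 6
  · refine AbelianVariety.isDivisorGenerated_powSucc_of_ribetTypeSixAll' X φ hd hφ he2
      ⟨eigenMultiplicity X φ (Complex.I * (Real.sqrt d : ℂ)) / 2, by omega⟩ (by omega) h6b N
  by_cases h7a : eigenMultiplicity X φ (Complex.I * (Real.sqrt d : ℂ)) = 7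
  · exact AbelianVariety.isDivisorGenerated_powSucc_of_ribetTypeSevenAll X φ hd hφ he2 h7a (by omega) N
  by_cases h7b : eigenMultiplicity X φ (-(Complex.I * (Real.sqrt d : ℂ))) = 7
  · exact AbelianVariety.isDivisorGenerated_powSucc_of_ribetTypeSevenAll' X φ hd hφ he2 (by omega) h7b N
  exact hS8 X φ d hp hs hd hφ he2 (by omega) (by omega) N

end Census

end Literature.AlgebraicGeometry.HodgeTheory

end
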